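import Literature.MathematicalPhysics.QuantumFieldTheory.Balaban1983to89.Beta.Drift
import Literature.MathematicalPhysics.QuantumFieldTheory.Balaban1983to89.Beta.MarginalTelescoping
import Literature.MathematicalPhysics.QuantumFieldTheory.Balaban1983to89.Beta.LargeL

/-!
# `Balaban1983to89.Beta.OneShotTelescope` — the ONE-SHOT / TELESCOPING reading of the one-loop input: the k = 0 rung at
blocking factor `n = L^k` feeds the DRIFT form directly (β sub-cell, lead's PROPOSED ROAD V22; BETA-SPEC §7.15)

HONEST FRAMING (cell rule, verbatim): discharging `BetaPertH` makes Bałaban's UV stability UNCONDITIONAL — a real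
constructive-QFT result; it is NOT the continuum limit and NOT the Clay problem.  (Gloss, BETA-SPEC v1.8d/v1.9b
l. 17–18, GAPS G-ref2-14 (a) / G-ref2-20 (a), verbatim: «UNCONDITIONAL» in [Balaban1989LargeFieldII] (B16) p. 355's
interval-hypothesis sense ONLY (`FlowStepRuns.p355Unconditional_of_partialSums` keeps `hnodes`); the located leaves
G-adv3-2 (left inequality of (0.1)/(2.50), d = 4), G-adv3-1 (U2 transfer of B14 Cor. 3's lower bound) and `SecondExpLeaf`
REMAIN.  Gloss 2, BETA-SPEC v1.9e, beta-ref C-beta-78, BINDING: «unconditional» = `Beta.Assembly.EventualForm`-unconditional END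
statement, NOT «Theorem 2 as printed».)  THIS MODULE DISCHARGES NOTHING of the series and asserts nothing about Bałaban's
β-functions: both inputs below (`hTel`, `hB`) are HYPOTHESES about arbitrary real sequences, located and unprinted for
Bałaban's coefficients.  Every declaration is `[folklore]`.  Value = road bookkeeping (audit cell `pub-balaban`, β sub-cell,
unit `b2b-balaban-strat-b12` gen 6), NOT summit progress.

WHAT THIS MODULE IS.  The sub-cell's wall has been attacked step by step: for every `k`, a window analysis of the
`(k+1)`-st one-loop coefficient `β⁰_{k+1}(L)` at LARGE blocking factor `L` ((AF-0-L), `Beta.LargeLWindow`,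
`Beta.WindowInterface`), which needs constants uniform in `k` AND `L`.  The tree's older DRIFT form (`Beta.Drift.OneLoopDrift`:
`|Σ_{j<k} β⁰_{j+1} − b·k| ≤ A`, «the marginal coefficient of the COMPOSED one-loop functional grows like b·(number of
scales) + O(1)») already gives the END statements (`Drift.endpointExistence_of_drift`, `Drift.p355Unconditional_of_drift`)
with NO sign condition on any individual `β⁰_{k+1}` and no `L → ∞`.  This file records the bridge between the two:
* (T1) TELESCOPING — HYPOTHESIS `hTel : ∀ k, Σ_{j<k} β⁰_j = B(L^k)` for some `B : ℕ → ℝ`: the partial sums of the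
  one-loop coefficients at blocking factor `L` are the values of ONE function of the total block scale `n = L^k`.  For
  Bałaban's scheme the candidate `B(n)` is the marginal one-loop coefficient of the COMPOSED effective action with
  `n`-blocks from the bare lattice.  Locators (v1.2 DOCFIX, adversarial cross-read C-adv2-37 / G-adv2-30): the
  recursion is [B12] (0.17)/(0.19) p. 255 — `A₁ = T₀A`, `A_{k+1}(g_{k+1},V) = (T_k A_k)(g_{k+1},V)`, a composite of k
  DIFFERENT coupling-dependent transformations `T_j` (each with its δ-constraint at the next scale, a gauge-fixing weight
  of strength `1/g_j²`, the small-field function `χ_j` and a normalisation), NOT a power of one `T`; [B12] (1.3)–(1.4)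
  p. 260 is the ADDITIVE form of `A_k` with the step Gaussian normalisations `Z^{(j)}(U_k) = ∫dB δ(Q̃B) exp[−½⟨B,
  Δ^{(j)}(U_k)B⟩]`; cf. [B4] p. 573 (1.13)–(1.14) «the effective Gaussian action after k renormalization transformations»
  (there with the RENORMALISED constant `a_k`).  What (T1) must certify is therefore MORE than Schur-complement
  multiplicativity of the δ-constrained Gaussian determinants: also the swap of k gauge-fixing layers at k scales for the
  reading chosen, and the additivity of the (1.22)-moment across steps (exact Ward / parity / constant-reproduction of the
  minimizer dressing — the β sub-cell's typed items (W3b-J)/(N7)); in the PRINT's own organisation this is the cell's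
  [H-germ] in the `MarginalTelescoping.SeparationRate` shape (§5).  NOT PROVED HERE, NOT PRINTED as such: a located
  structural statement to be certified.
* (T2) THE k = 0 RUNG, TWO-SIDED — HYPOTHESIS `hB : ∀ n ≥ 2, |B(n) − b·log n| ≤ A`: the one-step law for the FIRST
  step at blocking factor `n` (free bare-lattice propagators with the `n`-block constraint; the free rung of
  `Beta.BubbleTransfer` §8 / `Beta.TwoPowerLegs` §5 with the window inputs (W2′)₀/(W3a)₀/(W3b)₀ at `k = 0`, uniform in
  `n` along `n = L^k` at FIXED `L`).  `hB_of_logGrowth`: it is `Beta.LargeL.LogGrowth` read at `k = 0`.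
* CONCLUSIONS (kernel): (T1) + (T2) ⟹ `OneLoopDrift (b·log L) A β⁰` (`oneLoopDrift_of_telescope`; only the powers
  `n = L^k` are used: `oneLoopDrift_of_telescope_pow`) ⟹ with (AF-1) `|β¹| ≤ C_r·g_k`, `C_rγ₀ ≤ b·log L`:
  `FlowStepRuns.BetaPartialSumsLowerH (2A) γ₀ β` (`betaPartialSumsLowerH_of_telescope`), `EndpointExistence`
  (`endpointExistence_of_telescope`) — NO `L → ∞`, NO `k`-th-step propagator analysis, NO sign of any single `β⁰_{k+1}`.
What is NOT here: any claim that Bałaban's `β⁰` telescopes or that his first-step coefficient obeys the two-sided law;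
the road is PROPOSED (BETA-SPEC §7.15), its two hypotheses are the located unprinted content.

v1.2 (DOCFIX, docstring-only; every declaration byte-identical to v1.1 p181337): the (T1) bullet above re-located and de-escalated per the
adversarial cross-read (b2b-balaban-adv2-g25, C-adv2-37, objection G-adv2-30, DIVERGENCE D-adv2-4).
v1.1 (APPEND-ONLY; §1–§4 byte-identical to v1 p181240; CORRECTION OF RECORD, journal 00:08Z 2026-08-19).  The road is NOT new: (T1) is the
cell's [H-germ] (HOME/BETA/AN1.md §7 (T-drift); pv28's HGERM-READING.md; tree `Beta.MarginalTelescoping`: the composed marginal coefficient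
`composedCoeff μ k` versus `flowSum β0 k`, in the exact shape `IdentityForm` or in the PRINT's shape `SeparationRate C θ` — [B12] p. 290
(4.35)–(4.36), p. 292 l. 2–9, replacement terms small in `L^{−(k−j)}`), and the drift END chain is BETA-SPEC §8.2's «(H1) ∧ (H2) ∧ [H-germ] ⇒ (T-drift)
⇒ END».  What this module adds to §8 is the reading of the composed coefficient as the k = 0 RUNG of `Beta.WindowInterface` with blocking factor
`n = L^k` (so (T2) is `Beta.LargeLWindow.TwoSided.logGrowth` at `k = 0`).  §5 records the bridge in the print's shape: a two-sided law for the COMPOSED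
coefficient along `n = L^k` plus `SeparationRate` gives the drift with `A ↦ A + Cθ/(1−θ)` (`oneLoopDrift_of_composedLaw`, via
`MarginalTelescoping.oneLoopDrift_of_composedDrift`), hence the END statements (`betaPartialSumsLowerH_of_composedLaw`).

References (CONTEXT ONLY; nothing cited as a fact): [B12] T. Bałaban, CMP 109 (1987) 249–301, (1.3) p. 260,
(1.20)–(1.22) p. 264, Thm 2 p. 259; [B4] T. Bałaban, CMP 89 (1983) 571–597, (1.13)–(1.14) p. 573.
-/

namespace Literature.MathematicalPhysics.QuantumFieldTheory.Balaban1983to89.Beta.OneShotTelescope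

open Literature.MathematicalPhysics.QuantumFieldTheory.Balaban1983to89
open FlowStep FlowStepRuns DagBinding
open Literature.MathematicalPhysics.QuantumFieldTheory.Balaban1983to89.Beta.Drift (OneLoopDrift
  betaPartialSumsLowerH_of_drift endpointExistence_of_drift)
open Literature.MathematicalPhysics.QuantumFieldTheory.Balaban1983to89.Beta.LargeL (LogGrowth)

/-! ## 1. Telescoping + the two-sided k = 0 law ⟹ the drift form -/

/-- `log (L^m) = m·log L` for naturals, in the cast form used below. [folklore] -/
theorem log_natPow (L m : ℕ) : Real.log (((L ^ m : ℕ) : ℝ)) = (m : ℝ) * Real.log L := by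
  rw [Nat.cast_pow, Real.log_pow]

/-- **TELESCOPING + TWO-SIDED k = 0 LAW ALONG THE POWERS ⟹ DRIFT.**  If `Σ_{j<k} β0 j = B(L^k)` for all `k` and
`|B(L^m) − b·log L·m| ≤ A` for all `m ≥ 1` (`A ≥ 0`), then `OneLoopDrift (b·log L) A β0`. [folklore] -/
theorem oneLoopDrift_of_telescope_pow {β0 : ℕ → ℝ} {B : ℕ → ℝ} {L : ℕ} {b A : ℝ} (hA : 0 ≤ A)
    (hTel : ∀ k : ℕ, ∑ j ∈ Finset.range k, β0 j = B (L ^ k))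
    (hB : ∀ m : ℕ, 1 ≤ m → |B (L ^ m) - b * Real.log L * m| ≤ A) :
    OneLoopDrift (b * Real.log L) A β0 := by
  intro k
  rcases Nat.eq_zero_or_pos k with hk | hk
  · subst hk; simpa using hA
  · rw [hTel k]
    exact hB k hk

/-- **TELESCOPING + TWO-SIDED k = 0 LAW ⟹ DRIFT.**  If `Σ_{j<k} β0 j = B(L^k)` (`L ≥ 2`) and the first-step coefficient
obeys `|B(n) − b·log n| ≤ A` for every blocking factor `n ≥ 2`, then the partial sums drift linearly:
`OneLoopDrift (b·log L) A β0`, i.e. `|Σ_{j<k} β0 j − (b·log L)·k| ≤ A` for all `k`. [folklore] -/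
theorem oneLoopDrift_of_telescope {β0 : ℕ → ℝ} {B : ℕ → ℝ} {L : ℕ} {b A : ℝ} (hL : 2 ≤ L) (hA : 0 ≤ A)
    (hTel : ∀ k : ℕ, ∑ j ∈ Finset.range k, β0 j = B (L ^ k))
    (hB : ∀ n : ℕ, 2 ≤ n → |B n - b * Real.log n| ≤ A) :
    OneLoopDrift (b * Real.log L) A β0 := by
  refine oneLoopDrift_of_telescope_pow hA hTel fun m hm => ?_
  have hLm : 2 ≤ L ^ m :=
    calc 2 ≤ L ^ 1 := by simpa using hL
      _ ≤ L ^ m := Nat.pow_le_pow_right (by omega) hm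
  have h := hB (L ^ m) hLm
  rwa [log_natPow, show b * ((m : ℝ) * Real.log L) = b * Real.log L * m by ring] at h

/-- The two-sided k = 0 law is `Beta.LargeL.LogGrowth` (the two-sided (AF-0-L) shape) read at `k = 0`, for the
first-step family `B n := β0′ n 0`. [folklore] -/
theorem hB_of_logGrowth {β0' : ℕ → ℕ → ℝ} {b A : ℝ} (h : LogGrowth β0' b A) :
    ∀ n : ℕ, 2 ≤ n → |β0' n 0 - b * Real.log n| ≤ A := fun n hn => h n hn 0

/-! ## 2. The END statements from (T1) + (T2) + (AF-1) -/

/-- **(A-ps) FROM TELESCOPING.**  One-loop split `β = β⁰ + β¹`; (T1) `Σ_{j<k} β⁰_j = B(L^k)`; (T2) `|B(n) − b log n| ≤ A`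
(`n ≥ 2`); (AF-1) `|β¹_{k+1}| ≤ C_r·g_k` on `]0,γ₀]`-histories with `C_rγ₀ ≤ b·log L` ⟹
`FlowStepRuns.BetaPartialSumsLowerH (2A) γ₀ β` — the endpoint hypothesis of `FlowStepRuns` §7 with a `k`-INDEPENDENT
defect, no sign condition on any single `β⁰_{k+1}`, no `L → ∞`. (`Drift.betaPartialSumsLowerH_of_drift` ∘ §1.) [folklore] -/
theorem betaPartialSumsLowerH_of_telescope {β : HBeta} (S : B12Beta.OneLoopSplit β) {B : ℕ → ℝ} {L : ℕ}
    {b A Cr γ₀ : ℝ} (hL : 2 ≤ L) (hA : 0 ≤ A)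
    (hTel : ∀ k : ℕ, ∑ j ∈ Finset.range k, S.β0 j = B (L ^ k))
    (hB : ∀ n : ℕ, 2 ≤ n → |B n - b * Real.log n| ≤ A)
    (hAF1 : ∀ k (p : Fin (k + 1) → ℝ), p ∈ B12Beta.HistBox γ₀ k → |S.β1 k p| ≤ Cr * p (Fin.last k))
    (hCr : 0 ≤ Cr) (hγ : Cr * γ₀ ≤ b * Real.log L) :
    BetaPartialSumsLowerH (2 * A) γ₀ β :=
  betaPartialSumsLowerH_of_drift S (oneLoopDrift_of_telescope hL hA hTel hB) hAF1 hCr hγ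

/-- **ENDPOINT EXISTENCE FROM TELESCOPING** ([B12] Thm 2, first sentence, for forward-generated constructions): (T1) +
(T2) + (AF-1) + the printed-type continuity and upper bound. (`Drift.endpointExistence_of_drift` ∘ §1.)
[folklore] -/
theorem endpointExistence_of_telescope {C : B12.Construction} {β : HBeta} (hgen : ForwardGenerated C β)
    (S : B12Beta.OneLoopSplit β) {B : ℕ → ℝ} {L : ℕ} {γ₀ b A Cr β' : ℝ} (hγ₀ : 0 < γ₀) (hL : 2 ≤ L) (hA : 0 ≤ A)
    (hTel : ∀ k : ℕ, ∑ j ∈ Finset.range k, S.β0 j = B (L ^ k))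
    (hB : ∀ n : ℕ, 2 ≤ n → |B n - b * Real.log n| ≤ A)
    (hAF1 : ∀ k (p : Fin (k + 1) → ℝ), p ∈ B12Beta.HistBox γ₀ k → |S.β1 k p| ≤ Cr * p (Fin.last k))
    (hCr : 0 ≤ Cr) (hγ : Cr * γ₀ ≤ b * Real.log L) (hβ' : 0 ≤ β') (hcont : BetaContH γ₀ β)
    (hup : BetaUpperH β' γ₀ β) : EndpointExistence C :=
  endpointExistence_of_drift hgen S hγ₀ (oneLoopDrift_of_telescope hL hA hTel hB) hAF1 hCr hγ hβ' hcont hup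

/-! ## 3. What telescoping does to the per-step coefficients (record): no individual sign is needed or implied -/

/-- Under (T1) every single coefficient is a DIFFERENCE of the one-shot function: `β0 k = B(L^{k+1}) − B(L^k)`.
[folklore] -/
theorem beta0_eq_sub {β0 : ℕ → ℝ} {B : ℕ → ℝ} {L : ℕ} (hTel : ∀ k : ℕ, ∑ j ∈ Finset.range k, β0 j = B (L ^ k))
    (k : ℕ) : β0 k = B (L ^ (k + 1)) - B (L ^ k) := by
  have h1 := hTel (k + 1)
  rw [Finset.sum_range_succ, hTel k] at h1
  linarith

/-- Hence under (T1) + (T2) each `β0 k` is within `2A` of `b·log L` — an eventual SIGN would need `2A < b·log L`, which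
the drift road does NOT require. [folklore] -/
theorem abs_beta0_sub_le {β0 : ℕ → ℝ} {B : ℕ → ℝ} {L : ℕ} {b A : ℝ} (hL : 2 ≤ L) (hA : 0 ≤ A)
    (hTel : ∀ k : ℕ, ∑ j ∈ Finset.range k, β0 j = B (L ^ k))
    (hB : ∀ n : ℕ, 2 ≤ n → |B n - b * Real.log n| ≤ A) (k : ℕ) :
    |β0 k - b * Real.log L| ≤ 2 * A := by
  have hd := oneLoopDrift_of_telescope hL hA hTel hB
  have h := Drift.abs_sum_Ico_sub_le_of_drift hd (Nat.le_succ k)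
  rw [Finset.sum_Ico_succ_top (Nat.le_refl k), Finset.Ico_self, Finset.sum_empty, zero_add] at h
  have e : b * Real.log L * (((k + 1 : ℕ) : ℝ) - k) = b * Real.log L := by push_cast; ring
  rwa [e] at h

/-! ## 4. Consistency: the exact logarithm telescopes -/

/-- The model `β0 j := b·log L` telescopes with `B n := b·log n` and meets the two-sided law with `A = 0`. [folklore] -/
theorem telescope_model (b : ℝ) (L : ℕ) :
    (∀ k : ℕ, ∑ j ∈ Finset.range k, (fun _ : ℕ => b * Real.log L) j = (fun n : ℕ => b * Real.log n) (L ^ k)) ∧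
      ∀ n : ℕ, 2 ≤ n → |(fun n : ℕ => b * Real.log n) n - b * Real.log n| ≤ 0 := by
  refine ⟨fun k => ?_, fun n _ => by simp⟩
  simp only [Finset.sum_const, Finset.card_range, nsmul_eq_mul]
  rw [log_natPow]
  ring

/-! ## 5. (v1.1) The bridge in the PRINT's shape: composed two-sided law + `SeparationRate` ⟹ drift ⟹ END -/

section Composed

open Literature.MathematicalPhysics.QuantumFieldTheory.Balaban1983to89.Beta.MarginalTelescoping (composedCoeff SeparationRate
  oneLoopDrift_of_composedDrift)

/-- **[H-germ] IN THE PRINT'S SHAPE + THE TWO-SIDED LAW FOR THE COMPOSED COEFFICIENT ⟹ DRIFT.**  Let `μ j k` be the marginal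
contribution of old term `j` inside the step-`k` composed functional and `β0 j` the flow coefficients, with the separation-rate
defect `|μ j k − β0 j| ≤ Cθ^{k−j}` (`MarginalTelescoping.SeparationRate`, `0 ≤ C`, `0 ≤ θ < 1`).  If the COMPOSED coefficient obeys
the two-sided one-step law along the powers, `|composedCoeff μ m − b·log L·m| ≤ A` for all `m` (the k = 0 rung at blocking factor
`L^m`), then `OneLoopDrift (b·log L) (A + Cθ/(1−θ)) β0`. [folklore] -/
theorem oneLoopDrift_of_composedLaw {μ : ℕ → ℕ → ℝ} {β0 : ℕ → ℝ} {L : ℕ} {b A C θ : ℝ} (hC : 0 ≤ C) (hθ0 : 0 ≤ θ)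
    (hθ1 : θ < 1) (hsep : SeparationRate C θ μ β0)
    (hB : ∀ m : ℕ, |composedCoeff μ m - b * Real.log L * m| ≤ A) :
    OneLoopDrift (b * Real.log L) (A + C * θ / (1 - θ)) β0 :=
  oneLoopDrift_of_composedDrift hC hθ0 hθ1 hsep hB

/-- The same with the composed law stated through a first-step family `B : ℕ → ℝ` (`composedCoeff μ m = B (L^m)`) and the
two-sided law `|B n − b log n| ≤ A` for `n ≥ 2`, `L ≥ 2` (the `m = 0` instance is automatic: `composedCoeff μ 0 = 0`).
[folklore] -/
theorem oneLoopDrift_of_composedLaw' {μ : ℕ → ℕ → ℝ} {β0 : ℕ → ℝ} {B : ℕ → ℝ} {L : ℕ} {b A C θ : ℝ} (hL : 2 ≤ L)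
    (hA : 0 ≤ A) (hC : 0 ≤ C) (hθ0 : 0 ≤ θ) (hθ1 : θ < 1) (hsep : SeparationRate C θ μ β0)
    (hcomp : ∀ m : ℕ, composedCoeff μ m = B (L ^ m)) (hBn : ∀ n : ℕ, 2 ≤ n → |B n - b * Real.log n| ≤ A) :
    OneLoopDrift (b * Real.log L) (A + C * θ / (1 - θ)) β0 := by
  refine oneLoopDrift_of_composedLaw hC hθ0 hθ1 hsep fun m => ?_
  rcases Nat.eq_zero_or_pos m with hm | hm
  · subst hm
    simp [composedCoeff]
    exact hA
  · have hLm : 2 ≤ L ^ m :=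
      calc 2 ≤ L ^ 1 := by simpa using hL
        _ ≤ L ^ m := Nat.pow_le_pow_right (by omega) hm
    have h := hBn (L ^ m) hLm
    rw [hcomp m]
    rwa [log_natPow, show b * ((m : ℝ) * Real.log L) = b * Real.log L * m by ring] at h

/-- **(A-ps) IN THE PRINT'S SHAPE**: one-loop split + `SeparationRate` + the two-sided composed law + (AF-1) with
`C_rγ₀ ≤ b·log L` ⟹ `FlowStepRuns.BetaPartialSumsLowerH (2(A + Cθ/(1−θ))) γ₀ β`. [folklore] -/
theorem betaPartialSumsLowerH_of_composedLaw {β : HBeta} (S : B12Beta.OneLoopSplit β) {μ : ℕ → ℕ → ℝ} {L : ℕ}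
    {b A C θ Cr γ₀ : ℝ} (hC : 0 ≤ C) (hθ0 : 0 ≤ θ) (hθ1 : θ < 1) (hsep : SeparationRate C θ μ S.β0)
    (hB : ∀ m : ℕ, |composedCoeff μ m - b * Real.log L * m| ≤ A)
    (hAF1 : ∀ k (p : Fin (k + 1) → ℝ), p ∈ B12Beta.HistBox γ₀ k → |S.β1 k p| ≤ Cr * p (Fin.last k))
    (hCr : 0 ≤ Cr) (hγ : Cr * γ₀ ≤ b * Real.log L) :
    BetaPartialSumsLowerH (2 * (A + C * θ / (1 - θ))) γ₀ β :=
  betaPartialSumsLowerH_of_drift S (oneLoopDrift_of_composedLaw hC hθ0 hθ1 hsep hB) hAF1 hCr hγ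

/-- With the EXACT identity shape (`MarginalTelescoping.IdentityForm`: no replacement defect) the composed coefficient IS the
flow partial sum, so (T1) holds with `B (L^k) := composedCoeff μ k` read along the powers — the v1 hypothesis `hTel`.
[folklore] -/
theorem hTel_of_identityForm {μ : ℕ → ℕ → ℝ} {β0 : ℕ → ℝ} (h : MarginalTelescoping.IdentityForm μ β0) (k : ℕ) :
    ∑ j ∈ Finset.range k, β0 j = composedCoeff μ k :=
  (MarginalTelescoping.composedCoeff_eq_flowSum_of_identity h k).symm

end Composed

end Literature.MathematicalPhysics.QuantumFieldTheory.Balaban1983to89.Beta.OneShotTelescope
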